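import Literature.InformationTheory.QuantumCodes.QuantumExpanderNoisySyndromeWitnessGlobal
import HarnessLib

/-!
# Small-set-flip with a NOISY syndrome (Fawzi–Grospellier–Leverrier, FOCS 2018), part 6: the percolation hypothesis of
# Lemma 26 as the tree's `α`-cluster event on the syndrome adjacency graph `𝒢` (vertices `V ⊔ C_X`) — PROOF

Index of sources: `[cite: FawziGrospellierLeverrier2018FT]` = Fawzi–Grospellier–Leverrier, FOCS 2018 / arXiv:1808.03821, §3.4: the syndrome
adjacency graph `𝒢` (p0019 L3-4: "`𝒢` is equal to `G_X` with additional edges between the qubits which share an `X`-type or a `Z`-type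
generator … the set of vertices of `𝒢` is `𝒱 := V ∪ C_X`"), Def. 20 (`α`-subsets and `MaxConn_α` in `𝒢`), Lemma 26 (hypothesis
"`MaxConn_{α₀}(E ∪ D) ≤ γ₀√n`") and its proof (p0021 L2-5: "`K ∪ (D ∩ Γ_X(K))` is an `α₀`-subset of `E ∪ D` … we conclude that `|K| ≤ γ₀√n`"),
Lemma 27 (`α`-percolation on `𝒢`; = the STOC paper's Thm. 17, tree: `AlphaClusterCountingBound` / `AlphaPercolationThreshold`).

Topic `Literature/InformationTheory/QuantumCodes` (venture QEC, row 04 `prover-qec-type-04` gen 8, line L-SSF-NOISY = PARTITION v2.48 D50.L8,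
node N14). Parts 4–5 (`fgl18b_lemma26_equiv`, `fgl18b_lemma26_witness`) take the percolation hypothesis in the unfolded form "every
`𝒢|_V`-connected `K` whose mixed set `K ⊔ (D ∩ Γ_X(K))` is an `α₀`-subset of `(E ∩ K) ⊔ (D ∩ Γ_X(K))` is small". This file derives
that form from the tree's event `¬ HasAlphaCluster 𝒢 α₀ (t+1) (E ⊔ D)` for ANY graph `𝒢` on `V ⊔ C_X` (given as a parameter `G'`)
whose edges include the qubit adjacency (shared check or generator) and the incidences qubit–check of `H_X` — so that the tree's
`α`-percolation bound `sum_hasAlphaCluster_le_geometric` (Lemma 27) applies verbatim to `E ⊔ D = E.disjSum D`.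

* `isGraphConnected_disjSum_checks` — `K` connected in the qubit graph ⇒ `K ⊔ (D ∩ Γ_X(K))` connected in `𝒢`;
* `card_le_of_not_hasAlphaCluster_mixed` — `¬ MaxConn`: every such `K` with the `α`-subset inequality has `|K| + |D ∩ Γ_X(K)| ≤ t`;
* `fgl18b_lemma26_witness_of_not_hasAlphaCluster` — part 5's witness theorem with the hypothesis `¬ HasAlphaCluster 𝒢 α₀ (t+1) (E ⊔ D)`,
  `α₀ = κ/(2(κ + max Δ))`, `max Δ·t ≤ min Δ·min(γ_A n_A, γ_B n_B)`.

Column word: PROVED (kernel); no definitions (the mixed graph is a parameter with two edge hypotheses), no named facts.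
-/

namespace Literature.InformationTheory.QuantumCodes

open Finset Matrix Literature.Probability.LatticeModels

namespace SmallSetFlip

variable {Q C : Type*} [Fintype Q] [Fintype C] [DecidableEq Q] [DecidableEq C]

omit [Fintype Q] in
/-- **`K ⊔ (D ∩ Γ_X(K))` is connected in the syndrome adjacency graph** when `K ≠ ∅` is connected in the qubit graph: the qubit edges
lift (`hlift`) and every check of `Γ_X(K)` hangs on a qubit of `K` (`hinc`).
[cite: FawziGrospellierLeverrier2018FT, §3.4 (definition of 𝒢; arXiv p0019 L3-4) and proof of Lemma 26 ("K ∪ (D ∩ Γ_X(K)) … connected α-subset"; p0021 L2-5)] -/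
theorem isGraphConnected_disjSum_checks {G : SimpleGraph Q} {G' : SimpleGraph (Q ⊕ C)} {Hs : Matrix C Q (ZMod 2)}
    (hlift : ∀ q q', G.Adj q q' → G'.Adj (Sum.inl q) (Sum.inl q'))
    (hinc : ∀ c q, Hs c q ≠ 0 → G'.Adj (Sum.inl q) (Sum.inr c))
    (K : Finset Q) (hK : IsGraphConnected G K) (hKne : K.Nonempty) (D : Finset C) :
    IsGraphConnected G' (K.disjSum (D ∩ univ.filter fun c => ∃ q ∈ K, Hs c q ≠ 0)) := by
  classical
  obtain ⟨q₀, hq₀⟩ := hKne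
  set DK : Finset C := D ∩ univ.filter fun c => ∃ q ∈ K, Hs c q ≠ 0 with hDK
  set X : Finset (Q ⊕ C) := K.disjSum DK with hX
  have hq₀X : (Sum.inl q₀ : Q ⊕ C) ∈ X := by rw [hX, Finset.mem_disjSum]; exact Or.inl ⟨q₀, hq₀, rfl⟩
  rw [isGraphConnected_iff_reflTransGen (hv := hq₀X)]
  -- paths inside `K` lift to paths inside `X`
  have hpaths := (isGraphConnected_iff_reflTransGen (hv := hq₀)).1 hK
  have lift : ∀ q, Relation.ReflTransGen (fun a b => G.Adj a b ∧ a ∈ K ∧ b ∈ K) q₀ q →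
      Relation.ReflTransGen (fun a b => G'.Adj a b ∧ a ∈ X ∧ b ∈ X) (Sum.inl q₀) (Sum.inl q) := by
    intro q hq
    induction hq with
    | refl => exact Relation.ReflTransGen.refl
    | @tail s t _ hst ih =>
      refine ih.tail ⟨hlift s t hst.1, ?_, ?_⟩
      · rw [hX, Finset.mem_disjSum]; exact Or.inl ⟨s, hst.2.1, rfl⟩
      · rw [hX, Finset.mem_disjSum]; exact Or.inl ⟨t, hst.2.2, rfl⟩
  intro w hw
  rw [hX, Finset.mem_disjSum] at hw
  rcases hw with ⟨q, hq, rfl⟩ | ⟨c, hc, rfl⟩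
  · exact lift q (hpaths q hq)
  · have hc' := hc
    rw [hDK, Finset.mem_inter, Finset.mem_filter] at hc'
    obtain ⟨q, hqK, hcq⟩ := hc'.2.2
    refine (lift q (hpaths q hqK)).tail ⟨hinc c q hcq, ?_, ?_⟩
    · rw [hX, Finset.mem_disjSum]; exact Or.inl ⟨q, hqK, rfl⟩
    · rw [hX, Finset.mem_disjSum]; exact Or.inr ⟨c, hc, rfl⟩

omit [Fintype Q] in
/-- **The percolation hypothesis in the tree's vocabulary.** If `E ⊔ D ⊆ V ⊔ C_X` has NO connected `α`-subset with `t + 1` vertices in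
the syndrome adjacency graph (`¬ HasAlphaCluster G' α (t+1) (E.disjSum D)`, i.e. `MaxConn_α(E ∪ D) ≤ t`), then every `K` connected in the
qubit graph whose mixed set satisfies the `α`-subset inequality `α(|K| + |D ∩ Γ_X(K)|) ≤ |E ∩ K| + |D ∩ Γ_X(K)|` has
`|K| + |D ∩ Γ_X(K)| ≤ t`. [cite: FawziGrospellierLeverrier2018FT, Def 20 and proof of Lemma 26 (arXiv p0019 L12-20, p0021 L2-5)] -/
theorem card_le_of_not_hasAlphaCluster_mixed {G : SimpleGraph Q} {G' : SimpleGraph (Q ⊕ C)} {Hs : Matrix C Q (ZMod 2)}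
    (hlift : ∀ q q', G.Adj q q' → G'.Adj (Sum.inl q) (Sum.inl q'))
    (hinc : ∀ c q, Hs c q ≠ 0 → G'.Adj (Sum.inl q) (Sum.inr c))
    {α : ℝ} {t : ℕ} {E : Finset Q} {D : Finset C}
    (hno : ¬ HasAlphaCluster G' α (t + 1) (E.disjSum D))
    (K : Finset Q) (hK : IsGraphConnected G K)
    (hα : α * ((K.card : ℝ) + (D ∩ univ.filter fun c => ∃ q ∈ K, Hs c q ≠ 0).card)
      ≤ ((E ∩ K).card : ℝ) + (D ∩ univ.filter fun c => ∃ q ∈ K, Hs c q ≠ 0).card) :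
    K.card + (D ∩ univ.filter fun c => ∃ q ∈ K, Hs c q ≠ 0).card ≤ t := by
  classical
  set DK : Finset C := D ∩ univ.filter fun c => ∃ q ∈ K, Hs c q ≠ 0 with hDK
  by_cases hKne : K.Nonempty
  swap
  · rw [Finset.not_nonempty_iff_eq_empty] at hKne
    have hDK0 : DK = ∅ := by
      rw [hDK, hKne]; ext c; simp
    rw [hDK0, hKne]; simp
  set X : Finset (Q ⊕ C) := K.disjSum DK with hX
  have hconn : IsGraphConnected G' X := isGraphConnected_disjSum_checks hlift hinc K hK hKne D
  have hcardX : X.card = K.card + DK.card := Finset.card_disjSum _ _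
  have hinter : X ∩ E.disjSum D = (K ∩ E).disjSum DK := by
    ext w
    rw [Finset.mem_inter, hX, Finset.mem_disjSum, Finset.mem_disjSum, Finset.mem_disjSum]
    constructor
    · rintro ⟨h1, h2⟩
      rcases h1 with ⟨q, hq, rfl⟩ | ⟨c, hc, rfl⟩
      · rcases h2 with ⟨q', hq', hqq⟩ | ⟨c', -, hcc⟩
        · exact Or.inl ⟨q, Finset.mem_inter.2 ⟨hq, by cases hqq; exact hq'⟩, rfl⟩
        · cases hcc
      · exact Or.inr ⟨c, hc, rfl⟩
    · rintro (⟨q, hq, rfl⟩ | ⟨c, hc, rfl⟩)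
      · exact ⟨Or.inl ⟨q, (Finset.mem_inter.1 hq).1, rfl⟩, Or.inl ⟨q, (Finset.mem_inter.1 hq).2, rfl⟩⟩
      · refine ⟨Or.inr ⟨c, hc, rfl⟩, Or.inr ⟨c, ?_, rfl⟩⟩
        exact (Finset.mem_inter.1 (by rw [hDK] at hc; exact hc)).1
  have halpha : IsAlphaSubset α (E.disjSum D) X := by
    unfold IsAlphaSubset
    rw [hinter, hcardX, Finset.card_disjSum, Finset.inter_comm K E]
    push_cast
    exact hα
  by_contra hlt
  push Not at hlt
  exact hno ⟨X, hconn, by rw [hcardX]; omega, halpha⟩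

end SmallSetFlip

namespace QuantumExpander

variable {A B : Type*} [Fintype A] [Fintype B] [DecidableEq A] [DecidableEq B]

/-- **Lemma 26 (witness half) under the tree's `α`-cluster event.** As `fgl18b_lemma26_witness`, with the percolation hypothesis stated as
`¬ HasAlphaCluster 𝒢 α₀ (t + 1) (E ⊔ D)` for any graph `𝒢` on `V ⊔ C_X` containing the qubit adjacency of `checkGraph (H_X; H_Z)` and the
incidences of `H_X` (`α₀ = κ/(2(κ + max Δ))`, threshold `max Δ·t ≤ min Δ·min(γ_A n_A, γ_B n_B)`, printed `γ₀√n`): every check-closed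
`W ⊆ supp E_ls` has `|W| ≤ c₀·|D ∩ Γ_X(W)|`. The event's probability under local stochastic `(E, D)` is the tree's `α`-percolation bound
(`sum_hasAlphaCluster_le_geometric`, FGL18b Lemma 27) — not restated here.
[cite: FawziGrospellierLeverrier2018FT, Lemma 26 (arXiv p0020 L41-44), Lemma 27 (p0021 L12-20)] -/
theorem fgl18b_lemma26_witness_of_not_hasAlphaCluster (H : Matrix B A (ZMod 2)) {dA dB : ℕ} {γA δA γB δB : ℝ}
    (hreg : IsBiregular H dA dB) (hexp : IsLeftRightExpanding H dA dB γA δA γB δB)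
    (hdA : 0 < dA) (hdB : 0 < dB) (hδA : 0 ≤ δA) (hδB : 0 ≤ δB)
    {κ : ℝ} (hκ0 : 0 < κ) (hκ1 : 2 * κ < ((min dA dB : ℕ) : ℝ) * (1 - 16 * max δA δB))
    (G' : SimpleGraph (((A × A) ⊕ (B × B)) ⊕ (A × B)))
    (hlift : ∀ q q', (checkGraph (Matrix.fromRows (expanderHX H) (expanderHZ H))).Adj q q' →
      G'.Adj (Sum.inl q) (Sum.inl q'))
    (hinc : ∀ c q, expanderHX H c q ≠ 0 → G'.Adj (Sum.inl q) (Sum.inr c))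
    (Dec : Decoder (A × B → ZMod 2) ((A × A) ⊕ (B × B) → ZMod 2))
    (hDec : IsSSFDecoder κ (expanderHX H) (expanderHZ H) Dec)
    (E : Finset ((A × A) ⊕ (B × B))) (D : Finset (A × B))
    {t : ℕ} (ht : ((max dA dB : ℕ) : ℝ) * t ≤ ((min dA dB : ℕ) : ℝ) * min (γA * Fintype.card A) (γB * Fintype.card B))
    (hno : ¬ HasAlphaCluster G' (κ / (2 * (κ + ((max dA dB : ℕ) : ℝ)))) (t + 1) (E.disjSum D))
    (eLs : (A × A) ⊕ (B × B) → ZMod 2)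
    (hsyn : expanderHX H *ᵥ eLs = expanderHX H *ᵥ (flipVec E + Dec (expanderHX H *ᵥ flipVec E + flipVec D)))
    (hmin : ∀ v : (A × A) ⊕ (B × B) → ZMod 2, expanderHX H *ᵥ v = expanderHX H *ᵥ eLs →
      hammingNorm eLs ≤ hammingNorm v)
    (W : Finset ((A × A) ⊕ (B × B))) (hWsub : W ⊆ supp eLs)
    (hWX : ∀ q ∈ W, ∀ q' ∈ supp eLs, ∀ c, expanderHX H c q ≠ 0 → expanderHX H c q' ≠ 0 → q' ∈ W) :
    (W.card : ℝ) ≤ 4 / (((min dA dB : ℕ) : ℝ) * (1 - 16 * max δA δB) - 2 * κ)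
        * ((D ∩ univ.filter fun c => ∃ q ∈ W, expanderHX H c q ≠ 0).card : ℝ) := by
  classical
  refine fgl18b_lemma26_witness H hreg hexp hdA hdB hδA hδB hκ0 hκ1 Dec hDec E D eLs hsyn hmin ?_ W hWsub hWX
  intro K hK hineq
  have hdM0 : (0 : ℝ) ≤ ((max dA dB : ℕ) : ℝ) := Nat.cast_nonneg _
  have hpos : (0 : ℝ) < 2 * (κ + ((max dA dB : ℕ) : ℝ)) := by positivity
  -- the `α₀`-subset inequality in the normalised form
  have hα : κ / (2 * (κ + ((max dA dB : ℕ) : ℝ)))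
        * ((K.card : ℝ) + (D ∩ univ.filter fun c => ∃ q ∈ K, expanderHX H c q ≠ 0).card)
      ≤ ((E ∩ K).card : ℝ) + (D ∩ univ.filter fun c => ∃ q ∈ K, expanderHX H c q ≠ 0).card := by
    rw [div_mul_eq_mul_div, div_le_iff₀ hpos]
    linarith
  have hle := SmallSetFlip.card_le_of_not_hasAlphaCluster_mixed hlift hinc hno K hK hα
  have hKt : (K.card : ℝ) ≤ t := by exact_mod_cast le_trans (Nat.le_add_right _ _) hle
  exact le_trans (mul_le_mul_of_nonneg_left hKt hdM0) ht

end QuantumExpander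

end Literature.InformationTheory.QuantumCodes
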